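import Mathlib
import Literature.Computability.AlgebraicComplexity.FastFourierTransform
import Literature.Computability.AlgebraicComplexity.DivisionSLP
import Literature.LinearAlgebra.Matrix.CauchyLike

/-!
# Toeplitz-like to Cauchy-like conversion, I: shift algebra, Stein and Sylvester displacement

Helper file for the stub `stub_conversion` of the crux `HiddenToeplitzCorners.ToeplitzLikeDetCost`
(stmt-MatrixMultiplication-7491), line `Sketch`: the algebra of the lower shift `Z` on `Fin n`,
the reconstruction of a matrix from its Stein displacement `T - Z T Zᵀ = P Qᵀ`
(Kailath–Kung–Morf), the Sylvester displacement `Z_e T - T Z_f = G' H'ᵀ` w.r.t. the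
`e`/`f`-circulant shifts with its explicit length-`(β+2)` generator (Heinig 1995; Pan 2001, §4.7),
and the diagonalisation of `Z_e` by the twisted DFT matrix `(ε^j ω^{ij})`.

Target tree file:
`Summits/MatrixMultiplication/MatrixMultiplication/Theorems/HiddenToeplitzCornersToeplitzLikeDetCostConversionAux.lean`
(helper for the crux, landed with `--supports stmt-MatrixMultiplication-7491`).
-/

set_option linter.dupNamespace false

namespace Summit.MatrixMultiplication.MatrixMultiplication.Theorems

open scoped BigOperators Matrix
open Literature.Computability.AlgebraicComplexity Literature.LinearAlgebra.Matrix

section ShiftAlgebra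

variable {K : Type*} [Field K]

/-- A sum over `Fin n` supported on the single value `t : ℕ`. [folklore] -/
theorem conv_sum_ite_val_eq {M : Type*} [AddCommMonoid M] {n : ℕ} (t : ℕ) (f : Fin n → M) :
    (∑ l : Fin n, if (l : ℕ) = t then f l else 0) = if h : t < n then f ⟨t, h⟩ else 0 := by
  split_ifs with h
  · rw [Finset.sum_eq_single ⟨t, h⟩]
    · simp
    · intro l _ hl
      rw [if_neg]
      exact fun h' => hl (Fin.ext h')
    · exact fun h' => absurd (Finset.mem_univ _) h'
  · exact Finset.sum_eq_zero fun l _ => if_neg fun h' : (l : ℕ) = t => h (h' ▸ l.isLt)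

/-- A sum over `Fin n` supported on the predecessor of `i`. [folklore] -/
theorem conv_sum_ite_eq_val_succ {M : Type*} [AddCommMonoid M] {n : ℕ} (i : Fin n) (f : Fin n → M) :
    (∑ l : Fin n, if (i : ℕ) = (l : ℕ) + 1 then f l else 0) =
      if h : 1 ≤ (i : ℕ) then f ⟨(i : ℕ) - 1, by omega⟩ else 0 := by
  split_ifs with h
  · rw [Finset.sum_eq_single ⟨(i : ℕ) - 1, by omega⟩]
    · rw [if_pos]
      dsimp only
      omega
    · intro l _ hl
      rw [if_neg]
      intro h'
      exact hl (Fin.ext (by dsimp only; omega))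
    · exact fun h' => absurd (Finset.mem_univ _) h'
  · exact Finset.sum_eq_zero fun l _ => if_neg (by omega)

/-- `(Z M) i j = M (i-1) j` (and `0` in row `0`) for the lower shift `Z`. [folklore] -/
theorem conv_shift_mul_apply {n : ℕ} {m : Type*} (M : Matrix (Fin n) m K) (i : Fin n) (j : m) :
    ((Matrix.of fun i j : Fin n => if (i : ℕ) = (j : ℕ) + 1 then (1 : K) else 0) * M) i j =
      if h : 1 ≤ (i : ℕ) then M ⟨(i : ℕ) - 1, by omega⟩ j else 0 := by
  simp only [Matrix.mul_apply, Matrix.of_apply, ite_mul, one_mul, zero_mul]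
  exact conv_sum_ite_eq_val_succ i _

/-- `(Z v) i = v (i-1)` (and `0` at `0`) for the lower shift `Z`. [folklore] -/
theorem conv_shift_mulVec {n : ℕ} (v : Fin n → K) (i : Fin n) :
    (Matrix.of fun i j : Fin n => if (i : ℕ) = (j : ℕ) + 1 then (1 : K) else 0).mulVec v i =
      if h : 1 ≤ (i : ℕ) then v ⟨(i : ℕ) - 1, by omega⟩ else 0 := by
  simp only [Matrix.mulVec, dotProduct, Matrix.of_apply, ite_mul, one_mul, zero_mul]
  exact conv_sum_ite_eq_val_succ i _

/-- `(M Z) i j = M i (j+1)` (and `0` in the last column). [folklore] -/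
theorem conv_mul_shift_apply {n : ℕ} {m : Type*} (M : Matrix m (Fin n) K) (i : m) (j : Fin n) :
    (M * (Matrix.of fun i j : Fin n => if (i : ℕ) = (j : ℕ) + 1 then (1 : K) else 0)) i j =
      if h : (j : ℕ) + 1 < n then M i ⟨(j : ℕ) + 1, h⟩ else 0 := by
  simp only [Matrix.mul_apply, Matrix.of_apply, mul_ite, mul_one, mul_zero]
  exact conv_sum_ite_val_eq _ _

/-- `(Zᵀ M) i j = M (i+1) j` (and `0` in the last row). [folklore] -/
theorem conv_shiftT_mul_apply {n : ℕ} {m : Type*} (M : Matrix (Fin n) m K) (i : Fin n) (j : m) :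
    ((Matrix.of fun i j : Fin n => if (i : ℕ) = (j : ℕ) + 1 then (1 : K) else 0)ᵀ * M) i j =
      if h : (i : ℕ) + 1 < n then M ⟨(i : ℕ) + 1, h⟩ j else 0 := by
  simp only [Matrix.mul_apply, Matrix.transpose_apply, Matrix.of_apply, ite_mul, one_mul, zero_mul]
  exact conv_sum_ite_val_eq _ _

/-- `(M Zᵀ) i j = M i (j-1)` (and `0` in column `0`). [folklore] -/
theorem conv_mul_shiftT_apply {n : ℕ} {m : Type*} (M : Matrix m (Fin n) K) (i : m) (j : Fin n) :
    (M * (Matrix.of fun i j : Fin n => if (i : ℕ) = (j : ℕ) + 1 then (1 : K) else 0)ᵀ) i j =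
      if h : 1 ≤ (j : ℕ) then M i ⟨(j : ℕ) - 1, by omega⟩ else 0 := by
  simp only [Matrix.mul_apply, Matrix.transpose_apply, Matrix.of_apply, mul_ite, mul_one, mul_zero]
  exact conv_sum_ite_eq_val_succ j _

/-- Left multiplication by the corner matrix `c • E_{0,n-1}`. [folklore] -/
theorem conv_corner_mul_apply {n : ℕ} [NeZero n] {m : Type*} (c : K) (M : Matrix (Fin n) m K)
    (i : Fin n) (j : m) :
    ((Matrix.of fun i j : Fin n => if (i : ℕ) = 0 ∧ (j : ℕ) = n - 1 then c else 0) * M) i j =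
      if (i : ℕ) = 0 then c * M ⟨n - 1, Nat.sub_one_lt (NeZero.ne n)⟩ j else 0 := by
  simp only [Matrix.mul_apply, Matrix.of_apply]
  by_cases hi : (i : ℕ) = 0
  · simp only [hi, true_and, ite_mul, zero_mul, if_true]
    rw [conv_sum_ite_val_eq (n - 1) (fun l => c * M l j), dif_pos (Nat.sub_one_lt (NeZero.ne n))]
  · simp [hi]

/-- Right multiplication by the corner matrix `c • E_{0,n-1}`. [folklore] -/
theorem conv_mul_corner_apply {n : ℕ} [NeZero n] {m : Type*} (c : K) (M : Matrix m (Fin n) K)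
    (i : m) (j : Fin n) :
    (M * (Matrix.of fun i j : Fin n => if (i : ℕ) = 0 ∧ (j : ℕ) = n - 1 then c else 0)) i j =
      if (j : ℕ) = n - 1 then M i 0 * c else 0 := by
  simp only [Matrix.mul_apply, Matrix.of_apply]
  by_cases hj : (j : ℕ) = n - 1
  · simp only [hj, and_true, mul_ite, mul_zero, if_true]
    rw [conv_sum_ite_val_eq 0 (fun l => M i l * c), dif_pos (Nat.pos_of_ne_zero (NeZero.ne n))]
    rfl
  · simp [hj]

/-- Powers of the lower shift: `(Z^m) i a = [i = a + m]`. [folklore] -/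
theorem conv_shift_pow_apply {n : ℕ} (m : ℕ) (i a : Fin n) :
    ((Matrix.of fun i j : Fin n => if (i : ℕ) = (j : ℕ) + 1 then (1 : K) else 0) ^ m) i a =
      if (i : ℕ) = (a : ℕ) + m then 1 else 0 := by
  induction m generalizing i a with
  | zero => simp [Matrix.one_apply, Fin.ext_iff]
  | succ m ih =>
    rw [pow_succ, conv_mul_shift_apply]
    split_ifs with h1 h2 h2
    · rw [ih, if_pos]
      dsimp only
      omega
    · rw [ih, if_neg]
      dsimp only
      omega
    · exfalso
      omega
    · rfl

/-- **Reconstruction from the Stein displacement**: `T = ∑_{m<n} Z^m (P Qᵀ) (Zᵀ)^m` when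
`T - Z T Zᵀ = P Qᵀ` (`Z` nilpotent of index `n`). [folklore] -/
theorem conv_eq_sum_of_stein {n β : ℕ} {T : Matrix (Fin n) (Fin n) K} {P Q : Matrix (Fin n) (Fin β) K}
    (hT : T - (Matrix.of fun i j : Fin n => if (i : ℕ) = (j : ℕ) + 1 then (1 : K) else 0) * T *
      (Matrix.of fun i j : Fin n => if (i : ℕ) = (j : ℕ) + 1 then (1 : K) else 0)ᵀ = P * Qᵀ) :
    T = ∑ m ∈ Finset.range n,
      (Matrix.of fun i j : Fin n => if (i : ℕ) = (j : ℕ) + 1 then (1 : K) else 0) ^ m * (P * Qᵀ) *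
        ((Matrix.of fun i j : Fin n => if (i : ℕ) = (j : ℕ) + 1 then (1 : K) else 0)ᵀ) ^ m := by
  set Z : Matrix (Fin n) (Fin n) K :=
    Matrix.of fun i j : Fin n => if (i : ℕ) = (j : ℕ) + 1 then (1 : K) else 0 with hZ
  have hZn : Z ^ n = 0 := by
    ext i a
    rw [conv_shift_pow_apply, Matrix.zero_apply, if_neg]
    omega
  have key : ∀ m : ℕ, Z ^ m * (P * Qᵀ) * (Zᵀ) ^ m =
      Z ^ m * T * (Zᵀ) ^ m - Z ^ (m + 1) * T * (Zᵀ) ^ (m + 1) := by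
    intro m
    rw [← hT, Matrix.mul_sub, Matrix.sub_mul, pow_succ, pow_succ']
    simp only [Matrix.mul_assoc]
  simp_rw [key]
  rw [Finset.sum_range_sub', pow_zero, pow_zero, Matrix.one_mul, Matrix.mul_one, hZn,
    Matrix.zero_mul, Matrix.zero_mul, sub_zero]

/-- Entries of a matrix in terms of its Stein generator:
`T i j = ∑_m ∑_{a+m=i, b+m=j} (P Qᵀ) a b`. [folklore] -/
theorem conv_stein_entry {n β : ℕ} {T : Matrix (Fin n) (Fin n) K} {P Q : Matrix (Fin n) (Fin β) K}
    (hT : T - (Matrix.of fun i j : Fin n => if (i : ℕ) = (j : ℕ) + 1 then (1 : K) else 0) * T *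
      (Matrix.of fun i j : Fin n => if (i : ℕ) = (j : ℕ) + 1 then (1 : K) else 0)ᵀ = P * Qᵀ)
    (i j : Fin n) :
    T i j = ∑ m ∈ Finset.range n, ∑ a : Fin n, ∑ b : Fin n,
      if (i : ℕ) = a + m ∧ (j : ℕ) = b + m then ∑ k, P a k * Q b k else 0 := by
  conv_lhs => rw [conv_eq_sum_of_stein hT]
  rw [Matrix.sum_apply]
  refine Finset.sum_congr rfl fun m _ => ?_
  rw [← Matrix.transpose_pow, Matrix.mul_apply]
  simp_rw [Matrix.mul_apply, Finset.sum_mul]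
  rw [Finset.sum_comm]
  refine Finset.sum_congr rfl fun a _ => Finset.sum_congr rfl fun b _ => ?_
  by_cases h1 : (i : ℕ) = a + m <;> by_cases h2 : (j : ℕ) = b + m <;>
    simp [h1, h2, conv_shift_pow_apply, Matrix.transpose_apply]

/-- The last column of the reconstruction, as a convolution. [folklore] -/
theorem conv_sum_spec_lastCol {M : Type*} [AddCommMonoid M] {n : ℕ} (F : Fin n → Fin n → M) (i : Fin n) :
    (∑ m ∈ Finset.range n, ∑ a : Fin n, ∑ b : Fin n,
        if (i : ℕ) = a + m ∧ n - 1 = (b : ℕ) + m then F a b else 0) =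
      ∑ a : Fin n, ∑ b : Fin n, if (a : ℕ) + b = i then F a (Fin.rev b) else 0 := by
  rw [Finset.sum_comm]
  refine Finset.sum_congr rfl fun a _ => ?_
  rw [Finset.sum_comm]
  calc (∑ b : Fin n, ∑ m ∈ Finset.range n,
          if (i : ℕ) = a + m ∧ n - 1 = (b : ℕ) + m then F a b else 0)
      = ∑ b : Fin n, (if (a : ℕ) + (Fin.rev b : ℕ) = i then F a (Fin.rev (Fin.rev b)) else 0) := by
        refine Finset.sum_congr rfl fun b _ => ?_
        have hb := b.isLt
        rw [Finset.sum_eq_single (n - 1 - (b : ℕ)), Fin.rev_rev, Fin.val_rev]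
        · by_cases h : (i : ℕ) = a + (n - 1 - b)
          · rw [if_pos ⟨h, by omega⟩, if_pos (by omega)]
          · rw [if_neg fun h' => h h'.1, if_neg (by omega)]
        · intro m _ hm
          rw [if_neg]
          rintro ⟨_, h2⟩
          exact hm (by omega)
        · intro h
          exact absurd (Finset.mem_range.2 (by omega)) h
    _ = _ := Fintype.sum_equiv Fin.revPerm _ _ fun b => rfl

/-- The last row of the reconstruction, as a convolution. [folklore] -/
theorem conv_sum_spec_lastRow {M : Type*} [AddCommMonoid M] {n : ℕ} (F : Fin n → Fin n → M) (j : Fin n) :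
    (∑ m ∈ Finset.range n, ∑ a : Fin n, ∑ b : Fin n,
        if n - 1 = (a : ℕ) + m ∧ (j : ℕ) = b + m then F a b else 0) =
      ∑ a : Fin n, ∑ b : Fin n, if (a : ℕ) + b = j then F (Fin.rev a) b else 0 := by
  rw [Finset.sum_comm]
  calc (∑ a : Fin n, ∑ m ∈ Finset.range n, ∑ b : Fin n,
          if n - 1 = (a : ℕ) + m ∧ (j : ℕ) = b + m then F a b else 0)
      = ∑ a : Fin n, ∑ b : Fin n,
          (if (Fin.rev a : ℕ) + (b : ℕ) = j then F (Fin.rev (Fin.rev a)) b else 0) := by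
        refine Finset.sum_congr rfl fun a _ => ?_
        rw [Finset.sum_comm]
        refine Finset.sum_congr rfl fun b _ => ?_
        have ha := a.isLt
        rw [Finset.sum_eq_single (n - 1 - (a : ℕ)), Fin.rev_rev, Fin.val_rev]
        · by_cases h : (j : ℕ) = b + (n - 1 - a)
          · rw [if_pos ⟨by omega, h⟩, if_pos (by omega)]
          · rw [if_neg fun h' => h h'.2, if_neg (by omega)]
        · intro m _ hm
          rw [if_neg]
          rintro ⟨h1, _⟩
          exact hm (by omega)
        · intro h
          exact absurd (Finset.mem_range.2 (by omega)) h
    _ = _ := Fintype.sum_equiv Fin.revPerm _ _ fun a => rfl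

/-- The first column of the reconstruction. [folklore] -/
theorem conv_sum_spec_firstCol {M : Type*} [AddCommMonoid M] {n : ℕ} [NeZero n] (F : Fin n → Fin n → M)
    (i : Fin n) :
    (∑ m ∈ Finset.range n, ∑ a : Fin n, ∑ b : Fin n,
        if (i : ℕ) = a + m ∧ (0 : ℕ) = (b : ℕ) + m then F a b else 0) = F i 0 := by
  rw [Finset.sum_eq_single 0]
  · rw [Finset.sum_eq_single i]
    · rw [Finset.sum_eq_single 0]
      · simp
      · intro b _ hb
        rw [if_neg]
        rintro ⟨_, h2⟩
        exact hb (Fin.ext (by simp only [Fin.val_zero]; omega))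
      · exact fun h => absurd (Finset.mem_univ _) h
    · intro a _ ha
      refine Finset.sum_eq_zero fun b _ => ?_
      rw [if_neg]
      rintro ⟨h1, _⟩
      exact ha (Fin.ext (by omega))
    · exact fun h => absurd (Finset.mem_univ _) h
  · intro m _ hm
    refine Finset.sum_eq_zero fun a _ => Finset.sum_eq_zero fun b _ => ?_
    rw [if_neg]
    rintro ⟨_, h2⟩
    exact hm (by omega)
  · intro h
    exact absurd (Finset.mem_range.2 (Nat.pos_of_ne_zero (NeZero.ne n))) h


/-- **Sylvester displacement from Stein displacement** (Heinig 1995; Pan 2001, §4.7): if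
`T - Z T Zᵀ = P Qᵀ` then `Z_e T - T Z_f = G' H'ᵀ` for the `e`/`f`-circulant shifts
`Z_e = Z + e E_{0,n-1}`, with the explicit length-`(β+2)` generator built from the last column,
the last row and the first column of `T`. [cite: Pan2001, §4.7] -/
theorem conv_sylvester_of_stein {n β : ℕ} [NeZero n] {T : Matrix (Fin n) (Fin n) K}
    {P Q : Matrix (Fin n) (Fin β) K}
    (hT : T - (Matrix.of fun i j : Fin n => if (i : ℕ) = (j : ℕ) + 1 then (1 : K) else 0) * T *
      (Matrix.of fun i j : Fin n => if (i : ℕ) = (j : ℕ) + 1 then (1 : K) else 0)ᵀ = P * Qᵀ)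
    (cL rL c0 : Fin n → K) (hcL : ∀ i, cL i = T i ⟨n - 1, Nat.sub_one_lt (NeZero.ne n)⟩)
    (hrL : ∀ j, rL j = T ⟨n - 1, Nat.sub_one_lt (NeZero.ne n)⟩ j) (hc0 : ∀ i, c0 i = T i 0)
    (e f : K) :
    ((Matrix.of fun i j : Fin n => if (i : ℕ) = (j : ℕ) + 1 then (1 : K) else 0) +
        Matrix.of fun i j : Fin n => if (i : ℕ) = 0 ∧ (j : ℕ) = n - 1 then e else 0) * T -
      T * ((Matrix.of fun i j : Fin n => if (i : ℕ) = (j : ℕ) + 1 then (1 : K) else 0) +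
        Matrix.of fun i j : Fin n => if (i : ℕ) = 0 ∧ (j : ℕ) = n - 1 then f else 0) =
    Matrix.fromCols (Matrix.fromCols
        (Matrix.of fun (i : Fin n) (_ : Fin 1) =>
          (Matrix.of fun i j : Fin n => if (i : ℕ) = (j : ℕ) + 1 then (1 : K) else 0).mulVec cL i -
            f * c0 i)
        (Matrix.of fun (i : Fin n) (_ : Fin 1) => if (i : ℕ) = 0 then (1 : K) else 0)) (-P) *
      (Matrix.fromCols (Matrix.fromCols
        (Matrix.of fun (j : Fin n) (_ : Fin 1) => if (j : ℕ) = n - 1 then (1 : K) else 0)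
        (Matrix.of fun (j : Fin n) (_ : Fin 1) => e * rL j))
        ((Matrix.of fun i j : Fin n => if (i : ℕ) = (j : ℕ) + 1 then (1 : K) else 0)ᵀ * Q))ᵀ := by
  have hn := Nat.sub_one_lt (NeZero.ne n)
  -- the Stein equation entrywise
  have hS : ∀ a b : Fin n, T a b = (if h : 1 ≤ (b : ℕ) then
      (if h' : 1 ≤ (a : ℕ) then T ⟨(a : ℕ) - 1, by omega⟩ ⟨(b : ℕ) - 1, by omega⟩ else 0) else 0) +
        ∑ k, P a k * Q b k := by
    intro a b
    have h := congrFun (congrFun hT a) b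
    rw [Matrix.sub_apply, conv_mul_shiftT_apply] at h
    simp only [conv_shift_mul_apply] at h
    simp only [Matrix.mul_apply, Matrix.transpose_apply] at h
    rw [← h]
    abel
  set R := (Matrix.of fun i j : Fin n => if (i : ℕ) = (j : ℕ) + 1 then (1 : K) else 0)ᵀ * Q
    with hR
  ext i j
  rw [Matrix.transpose_fromCols, Matrix.transpose_fromCols, Matrix.fromCols_mul_fromRows,
    Matrix.fromCols_mul_fromRows, Matrix.sub_apply, Matrix.add_mul, Matrix.mul_add,
    Matrix.add_apply, Matrix.add_apply, Matrix.add_apply, Matrix.add_apply, conv_shift_mul_apply,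
    conv_corner_mul_apply, conv_mul_shift_apply, conv_mul_corner_apply]
  simp only [Matrix.mul_apply, Fintype.sum_unique, Matrix.transpose_apply, Matrix.of_apply,
    Matrix.neg_apply, conv_shift_mulVec, hcL, hrL, hc0]
  simp only [hR, conv_shiftT_mul_apply]
  by_cases hj : (j : ℕ) + 1 < n
  · have hj' : (j : ℕ) ≠ n - 1 := by omega
    have hj1 : 1 ≤ (j : ℕ) + 1 := by omega
    have e1 : (⟨(j : ℕ) + 1 - 1, by omega⟩ : Fin n) = j := Fin.ext (by simp)
    simp only [hj, dif_pos]
    rw [hS i ⟨(j : ℕ) + 1, hj⟩]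
    by_cases hi : 1 ≤ (i : ℕ)
    · have hi' : (i : ℕ) ≠ 0 := by omega
      simp only [hj', hj1, hi, hi', dif_pos, if_false, e1, Finset.sum_neg_distrib, neg_mul]
      ring
    · have hi' : (i : ℕ) = 0 := by omega
      simp only [hj', hj1, hi', dif_pos, if_false, if_true, e1, Finset.sum_neg_distrib, neg_mul]
      ring
  · have hj' : (j : ℕ) = n - 1 := by omega
    have e1 : j = ⟨n - 1, hn⟩ := Fin.ext hj'
    subst e1
    by_cases hi : 1 ≤ (i : ℕ)
    · have hi' : (i : ℕ) ≠ 0 := by omega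
      simp [hj, hi, hi']
      ring
    · have hi' : (i : ℕ) = 0 := by omega
      simp [hj, hi']
      ring

/-- **Diagonalisation of the `e`-circulant shift by the twisted DFT**: the rows of `(ε^j ω^{ij})`
are left eigenvectors of `Z + ε^n E_{0,n-1}` with eigenvalues `ε ω^i`. [cite: Pan2001, §4.7] -/
theorem conv_diagonal_mul_twistedDFT {n : ℕ} [NeZero n] (ε ω : K) (hω : ω ^ n = 1) :
    Matrix.diagonal (fun i : Fin n => ε * ω ^ (i : ℕ)) *
        (Matrix.of fun i j : Fin n => ε ^ (j : ℕ) * ω ^ ((i : ℕ) * j)) =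
      (Matrix.of fun i j : Fin n => ε ^ (j : ℕ) * ω ^ ((i : ℕ) * j)) *
        ((Matrix.of fun i j : Fin n => if (i : ℕ) = (j : ℕ) + 1 then (1 : K) else 0) +
          Matrix.of fun i j : Fin n => if (i : ℕ) = 0 ∧ (j : ℕ) = n - 1 then ε ^ n else 0) := by
  ext i j
  rw [Matrix.mul_add, Matrix.add_apply, conv_mul_shift_apply, conv_mul_corner_apply, Matrix.diagonal_mul,
    Matrix.of_apply]
  by_cases hj : (j : ℕ) + 1 < n
  · rw [dif_pos hj, if_neg (by omega), add_zero, Matrix.of_apply]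
    dsimp only
    ring
  · have hj' : (j : ℕ) + 1 = n := by omega
    rw [dif_neg hj, if_pos (by omega), zero_add, Matrix.of_apply, Fin.val_zero]
    calc ε * ω ^ (i : ℕ) * (ε ^ (j : ℕ) * ω ^ ((i : ℕ) * j))
        = ε ^ ((j : ℕ) + 1) * (ω ^ ((j : ℕ) + 1)) ^ (i : ℕ) := by ring
      _ = _ := by rw [hj', hω]; simp


/-- The operation count of the conversion: `2β` polynomial products, `O(β n)` bookkeeping and
`2(β+2)` FFT passes fit in the budget `40 (β+2) (κ+4) 2^κ`. [folklore] -/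
theorem conv_cost_bound (β κ : ℕ) :
    32 * β * 2 ^ κ * (κ + 4) + (5 * β + 2) * 2 ^ κ + (1 + 1 + β) * ((2 * κ + 3) * 2 ^ κ) ≤
      40 * (β + 2) * (κ + 4) * 2 ^ κ :=
  calc 32 * β * 2 ^ κ * (κ + 4) + (5 * β + 2) * 2 ^ κ + (1 + 1 + β) * ((2 * κ + 3) * 2 ^ κ)
      ≤ 32 * β * 2 ^ κ * (κ + 4) + (5 * β + 2) * 2 ^ κ + (1 + 1 + β) * ((2 * κ + 3) * 2 ^ κ)
        + (6 * β * κ * 2 ^ κ + 24 * β * 2 ^ κ + 76 * κ * 2 ^ κ + 312 * 2 ^ κ) :=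
        Nat.le_add_right _ _
    _ = 40 * (β + 2) * (κ + 4) * 2 ^ κ := by ring

end ShiftAlgebra

end Summit.MatrixMultiplication.MatrixMultiplication.Theorems
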